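import Summits.BirchSwinnertonDyer.BirchSwinnertonDyer.Theorems.SignedLowerHalvesSprungLowerHalfAtThreeFWLocus
import HarnessLib

/-!
# Route `SignedLowerHalves`, crux `SprungLowerHalfAtThree` (item stmt-BirchSwinnertonDyer-19003): the
# TAMAGAWA ZONE — clause (B) (`stub_chromaticDivisibility`) holds with NO open binder wherever
# `ord_3(L(E,1)/Ω_E) ≤ ord_3 ∏_ℓ c_ℓ` (equivalently `ord_3 #Ш_an ≤ 0`), so the crux's open content on the
# leaf's regime is confined to the X8 pairs with `3 ∣ #Ш_an` — the board A8 proper (cell `bsd-ssimc`, seat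
# `bsd-ssimc-k3-c5` gen 2; a `--supports … --as helper` file, closes nothing)

PARTITION (cell bsd-ssimc): X8 (A8) — complement of the board inside the class: every X8 pair of analytic
rank ≤ 1 with `ord_3 #Ш_an ≤ 0` (in the window N < 5·10⁵ these are the X8 pairs NOT among the 217 board
cells, which are cut out by `3 ∣ #Ш_an · ∏c`; on the board itself the 61 + 55 cells with `3 ∣ ∏c` and
`Ш_an` a `3`-adic unit also fall here) — types-the-object-of; closes NONE. THEOREMS ONLY; nothing booked.

Companion of `SignedLowerHalvesSprungLowerHalfAtThreeChromaticReduction.lean` (p417882): there clause (B) of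
crux 5 at analytic rank `0` was shown to be EXACTLY the Λ-free lower bound `MissingLowerBoundAt W 3`
(`ord_3 #Ш_an ≤ ord_3 #Ш`). That inequality is EMPTY when `ord_3 #Ш_an ≤ 0` (`#Ш ≥ 1`). In analytic rank `0`,
`#Ш_an = (L(E,1)/Ω_E) · #E(ℚ)_tors² / ∏c_ℓ` with `3 ∤ #E(ℚ)_tors` (`E[3]` irreducible on X8), so the zone is
`ord_3(L(E,1)/Ω_E) ≤ ord_3 ∏c_ℓ` — the «Tamagawa-dominated» pairs. Hence, granted only the PUBLISHED facts
GZK, `hasEntireLFunction_rat` and the period-ratio unit at `3`, the registered stub (B) holds on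
X8 ∩ {r_an ≤ 1} ∩ {`ord_3(L(E,1)/Ω_E) ≤ ord_3 ∏c`} with no PRE binder: the crux's genuinely open content
(the Eisenstein half of the ♯/♭ main conjecture read at the constant term) lives on the X8 pairs with
`3 ∣ #Ш_an`, i.e. on board A8 proper (136 (+81~) rank-0 cells in the window) — the kernel form of the
planner's reading «non-trivial only when `3 ∣ #Ш_an`» (TARGET §1.3). Nothing here is new mathematics; it
fixes the boundary of what the binders of the companion files are FOR.

References: [Sprung2017] Cor. 4.11; [GreenbergLNM1716] §4; [Mazur1977] III.5; [Miller2011LMS] Def. 1.1.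
-/

set_option autoImplicit false
set_option linter.dupNamespace false

noncomputable section

open scoped Classical MatrixGroups ModularForm

open CongruenceSubgroup WeierstrassCurve Literature.NumberTheory.EllipticCurves
  Literature.NumberTheory.EllipticCurves.ModularForms
  Literature.NumberTheory.EllipticCurves.Rank1Residual
  Literature.NumberTheory.EllipticCurves.Rank1Residual.Typed
  Literature.NumberTheory.EllipticCurves.Sprung2017
  Summit.BirchSwinnertonDyer.Rank1Residual.Supersingular

namespace Summit.BirchSwinnertonDyer.BirchSwinnertonDyer.Theorems

section Zone

variable (W : WeierstrassCurve ℚ) [W.IsElliptic] [W.IsGloballyMinimal] (p : ℕ) [Fact p.Prime]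

omit [W.IsGloballyMinimal] in
/-- **Analytic rank `0`, Tamagawa zone ⇒ the lower half.** If `ord_{s=1} L(E,s) = 0`, `E[p]` is irreducible
(so `p ∤ #E(ℚ)_tors`, Mazur), `L(E,1)/Ω_E = t ∈ ℚ` and `ord_p t ≤ ord_p ∏_ℓ c_ℓ`, then `ord_p #Ш_an =
ord_p t − ord_p ∏c ≤ 0 ≤ ord_p #Ш`: `MissingLowerBoundAt W p` with no Iwasawa-theoretic input (GZK `hGZK`
for `#Ш_an = t·#tors²/∏c`; the content rows of the lower half are `p ∣ #Ш_an`, cf. the additive cell's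
`N10.missingLowerBoundAt_of_padicValRat_le_zero`). [cite: GreenbergLNM1716, §4 p. 103] [cite: Miller2011LMS, Def. 1.1] -/
theorem missingLowerBoundAt_of_analyticRank_eq_zero_of_val_le_tamagawa
    (hGZK : rank_eq_analyticRank_of_analyticRank_le_one) (hr : W.analyticRank = 0)
    (hirr : W.HasIrreducibleModPGaloisRep p) {t : ℚ}
    (ht : W.entireLFunction 1 / (W.realPeriodRat : ℂ) = (t : ℂ)) (ht0 : t ≠ 0)
    (hv : padicValRat p t ≤ padicValNat p W.tamagawaProduct) : MissingLowerBoundAt W p := by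
  -- `#Ш_an = t·#tors²/∏c` has `ord_p ≤ 0 ≤ ord_p #Ш` (the trivial-content lemma
  -- `N10.missingLowerBoundAt_of_padicValRat_le_zero` of the additive cell, inlined to keep imports light)
  refine ⟨t * (W.torsionOrder : ℚ) ^ 2 / (W.tamagawaProduct : ℚ), ?_, ?_⟩
  · exact_mod_cast shaAn_eq_of_analyticRank_eq_zero W hGZK hr ht
  · rw [padicValRat_shaAn_witness W p hirr ht0]
    have h0 : (0 : ℤ) ≤ (padicValNat p W.shaOrder : ℤ) := by positivity
    linarith

/-- **X8, analytic rank ≤ 1, Tamagawa zone: `stub_chromaticDivisibility` with NO open binder.** For a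
globally minimal `W` on class X8 (`p = 3`, good supersingular, `a_3 = ±3`) with `ord_{s=1} L(E,s) ≤ 1` and
— in case `ord_{s=1} L(E,s) = 0` — `L(E,1)/Ω_E = t` with `ord_3 t ≤ ord_3 ∏_ℓ c_ℓ` (equivalently
`ord_3 #Ш_an ≤ 0`): for ANY newform `f` of `W`, its period ratio `ϖ` and ANY Sprung pair, clause (B) of
crux 5 holds (colour `♭`), granted only the PUBLISHED facts GZK (`hGZK`), `hasEntireLFunction_rat` (`hmod`)
and the period-ratio unit at `3` (`h3`). Cases: `Sel_{3^∞}(E/ℚ)` infinite ⇒ trivial witness; finite ⇒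
Mordell–Weil rank `0` ⇒ `r_an = 0` (GZK) ⇒ the zone hypothesis gives `MissingLowerBoundAt W 3`
(previous theorem; `E[3]` irreducible by `ClassX8.irr`) ⇒ (B) by `chromaticDatum_of_missingLowerBoundAt`.
UPSHOT: the OPEN content of crux 5's divisibility clause in the leaf's regime is confined to the X8 pairs
with `3 ∣ #Ш_an` (board A8 proper); everywhere else (B) is bookkeeping. CONDITIONAL on the three published
facts only; closes nothing. [cite: Sprung2017, Cor. 4.11 (table of special values)]
[cite: GreenbergVatsal2000, §3 Remark 3.4] [cite: GreenbergLNM1716, §1 p. 54 and §4 p. 103]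
[cite: Miller2011LMS, Def. 1.1] -/
theorem X8_chromaticDivisibility_of_val_le_tamagawa_of_analyticRank_le_one
    (hGZK : rank_eq_analyticRank_of_analyticRank_le_one) (hmod : hasEntireLFunction_rat)
    (h3 : realPeriodRat_eq_unit_mul_plusPeriod_three)
    (W : WeierstrassCurve ℚ) [W.IsElliptic] [W.IsGloballyMinimal] (p : ℕ) [Fact p.Prime]
    (hX : ClassX8 W p) (hr : W.analyticRank ≤ 1)
    (hzone : W.analyticRank = 0 → ∃ t : ℚ, W.entireLFunction 1 / (W.realPeriodRat : ℂ) = (t : ℂ) ∧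
      padicValRat p t ≤ padicValNat p W.tamagawaProduct)
    {N : ℕ} [NeZero N] {f : CuspForm (Gamma0 N) 2} (hf : IsNewformOf W f)
    {ϖ : ℚ} (hϖ : (ϖ : ℝ) * W.realPeriodRat = plusPeriod f)
    {Lsharp Lflat : IwasawaAlgebra p} (hSP : IsSprungPair f p (W.frobeniusTrace p) Lsharp Lflat) :
    ∃ (c : Chroma) (ξ : IwasawaAlgebra p), (⟨ξ, 0, 0⟩ : SignedDatum W p).EulerCharacteristic ∧
      ∃ h : IwasawaAlgebra p, iwasawaToPowerSeries p ξ =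
        PowerSeries.C (ϖ : ℚ_[p]) * iwasawaToPowerSeries p (chromaticL c Lsharp Lflat * h) := by
  have hp3 : p = 3 := hX.1
  subst hp3
  by_cases hfin : Finite (W.selmerGroupPInfty 3)
  · have hrk : W.mordellWeilRank = 0 := mordellWeilRank_eq_zero_of_finite_selmerGroupPInfty W 3 hfin
    have hr0 : W.analyticRank = 0 := by
      have h := (hGZK W hr).1
      omega
    have hL : W.entireLFunction 1 ≠ 0 := (W.analyticRank_eq_zero_iff_holds (hmod W)).1 hr0
    obtain ⟨t, ht, hv⟩ := hzone hr0
    have ht0 : t ≠ 0 := by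
      intro h0
      rw [h0, Rat.cast_zero, div_eq_zero_iff] at ht
      rcases ht with h | h
      · exact hL h
      · exact W.realPeriodRat_pos_holds.ne' (Complex.ofReal_eq_zero.mp h)
    have hlow : MissingLowerBoundAt W 3 :=
      missingLowerBoundAt_of_analyticRank_eq_zero_of_val_le_tamagawa W 3 hGZK hr0 (ClassX8.irr W 3 hX)
        ht ht0 hv
    have hϖ1 : ‖(ϖ : ℚ_[3])‖ ≤ 1 := (X8_norm_periodRatio_eq_one h3 W 3 hX hf hϖ).le
    obtain ⟨ξ, hK, hdiv⟩ := chromaticDatum_of_missingLowerBoundAt W 3 hGZK (by decide) hX.2.1.1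
      (ClassX8.irr W 3 hX) hL hf hϖ hϖ1 hSP .flat (ClassX8.not_dvd_chromaticConst' W 3 hX .flat) hlow
    exact ⟨.flat, ξ, hK, hdiv⟩
  · obtain ⟨ξ, hK, hdiv⟩ := chromaticDatum_of_not_finite_selmer W 3 hfin ϖ (chromaticL .flat Lsharp Lflat)
    exact ⟨.flat, ξ, hK, hdiv⟩

end Zone

end Summit.BirchSwinnertonDyer.BirchSwinnertonDyer.Theorems

end
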